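import Literature.NumberTheory.LFunctions.ExceptionalCharacterTwinPrimes
import Literature.NumberTheory.LFunctions.ExceptionalCharacterPrimesInProgressions
import Literature.NumberTheory.LFunctions.ExplicitDeuringHeilbronnDirichlet
import Literature.NumberTheory.LFunctions.DirichletLDerivativeLogSqBound
import Literature.NumberTheory.LFunctions.SiegelZeroQualityBound
import Literature.NumberTheory.LFunctions.SiegelTheorem
import HarnessLib
import Summits.Parity.GeneralizedHardyLittlewood.Theorems.UnboundedSiegelZeros

/-!
# Siegel zeros of poly-logarithmic strength and bounded gaps in prime `m`-tuples (Wright 2024)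

Topic `Literature/NumberTheory/LFunctions` (namespace `Literature.NumberTheory.LFunctions`; the
paper's hypothesis in the sub-namespace `WrightPrimeTuples`). STATEMENT LAYER for the cell
`parity-realchar` (SIEGEL INSTRUMENT, D-0070 deliverable (3), topic I.4 "prime pairs / tuples of
Heath-Brown 1983 type"). Source: T. Wright, *Prime tuples and Siegel zeros*, Bull. London Math.
Soc. 56 (2024) 644–661 [Wright2023PrimeTuplesSiegel], §3 "Main Result" (the two displayed theorems),
§13 Theorem 13.2, §14, read from the held copy arXiv:2111.14054 (pp. 5, 15–16). The tree already
quotes the headline `H_m ≪ e^{1.9828 m}` as CONTEXT in `Literature/Barriers/Parity/SiegelZeroDichotomy.lean`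
(evasions_known); here the theorems are typed as named facts with their hypothesis as a predicate of
the column's ONE family (HOME/CONDITIONALS.md §1), together with PROVED comparison lemmas.

* HYPOTHESIS (§3, p. 5): "Assume that there are infinitely many `D` and `χ_D` such that
  `L(s, χ_D) = 0` for some `s` with `Re(s) > 1 − 1/(log D)^{r^r + A}`, where `r = 554,401` and
  `A > 2`." — `WrightPrimeTuples.StrongSiegelZeros A` (a PREDICATE; nothing asserted), rendered with
  `χ_D` a primitive quadratic character `≠ 1` mod `D` (§2: "`χ` must be a real-valued character …
  derived from the Kronecker symbol") and the zero REAL (`s = β ∈ ℝ`; §2: "if such a zero exists, it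
  must be real" — taking it real makes the hypothesis stronger, the typed theorems weaker than
  print, the safe direction); `r = FI2003.r` of `ExceptionalCharacterPrimesInProgressions.lean` (the
  exponent is Friedlander–Iwaniec 2003's, which the proof uses).
* NAMED FACTS (not proved here): `wright2023_primeTuples_exp` — "Then for any `m ≥ 1`,
  `H_m ≪ e^{1.9828 m}`" (in the tree's wording of `frequently_nth_prime_add_le_maynard_tao`:
  infinitely often `p_{n+m} ≤ p_n + C e^{1.9828 m}`); `wright2023_primeTuples_small` — "With the same
  assumptions … `H_2 ≤ 264`, `H_3 ≤ 49,342`, `H_4 ≤ 442,052`, `H_5 ≤ 3,788,384`" (§3; §13 Theorem 13.2,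
  §14). (`H_m` = "the smallest number such that there are infinitely many sets of `m + 1` primes of
  difference `H_m`", p. 3, i.e. `liminf (p_{n+m} − p_n)`.)
* PROVED comparisons with the column's family: `StrongSiegelZeros.unboundedSiegelZeros` (⇒
  Tao–Teräväinen's `UnboundedSiegelZeros`: quality `η = 1/((1−β) log D) > (log D)^{r^r+A−1} → ∞`);
  `StrongSiegelZeros.smallEtaCharacters` (⇒ every `SmallEtaCharacters ε`, `ε > 0`, via
  Benli–Goel–Twiss–Zaman's explicit Lemma 2.9 `L(1,χ) ≤ 0.18 log²D (1 − β)` — so Friedlander–Iwaniec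
  2019 / Heath-Brown give `H_1 = 2` under the same hypothesis, consistent with Wright's remark that his
  `H_1 ≤ 12` "is obviously majorized by Heath-Brown's result"); `StrongSiegelZeros.of_strength`
  (⇐ `ExceptionalCharactersOfStrength (r^r + A + 1)`, via the tree's PROVED Hecke–Landau converse
  `exists_exceptionalZero_of_norm_LFunction_one_lt`: `1 − β₁ ≤ K‖L(1,χ)‖`).

WHAT THIS IS NOT: no claim that such zeros exist; certified tables only push witnesses beyond their
range (every witness of `StrongSiegelZeros A` has conductor `> 10¹⁰` under `NoRealZeroUpTo_1e10`:
`StrongSiegelZeros.witness_above`); nothing here bears on parity. No instances, no notation.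
-/

noncomputable section

open Filter
open scoped Classical

namespace Literature.NumberTheory.LFunctions

open Literature.Barriers.Parity

namespace WrightPrimeTuples

/-- **Wright's hypothesis** (§3): "there are infinitely many `D` and `χ_D` such that `L(s, χ_D) = 0`
for some `s` with `Re(s) > 1 − 1/(log D)^{r^r + A}`, where `r = 554,401`" — for every `q₀` there is
a conductor `D ≥ q₀`, a primitive quadratic `χ ≠ 1` mod `D` and a REAL zero `β` of `L(s, χ)` with
`β > 1 − (log D)^{−(r^r + A)}` (`r = FI2003.r`). A PREDICATE in `A`, never asserted (expected false:
it implies `UnboundedSiegelZeros`, `StrongSiegelZeros.unboundedSiegelZeros`).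
[cite: Wright2023PrimeTuplesSiegel, §3 Main Result (hypothesis of the first Theorem)] -/
def StrongSiegelZeros (A : ℝ) : Prop :=
  ∀ q₀ : ℕ, ∃ (D : ℕ) (_ : NeZero D) (χ : DirichletCharacter ℂ D) (β : ℝ),
    q₀ ≤ D ∧ χ.IsPrimitive ∧ χ.IsQuadratic ∧ χ ≠ 1 ∧ χ.LFunction β = 0 ∧
      1 - 1 / Real.log D ^ ((FI2003.r : ℝ) ^ FI2003.r + A) < β

end WrightPrimeTuples

open WrightPrimeTuples

/-- **Wright 2024, §3 Main Result, first Theorem (NAMED FACT, as printed).** "Assume that there are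
infinitely many `D` and `χ_D` such that `L(s, χ_D) = 0` for some `s` with
`Re(s) > 1 − 1/(log D)^{r^r + A}`, where `r = 554,401` and `A > 2`. Then for any `m ≥ 1`,
`H_m ≪ e^{1.9828 m}`." Rendered (as the tree's `frequently_nth_prime_add_le_maynard_tao`): for
`A > 2`, under `StrongSiegelZeros A` there is `C` such that for every `m ≥ 1`, infinitely often
`p_{n+m} ≤ p_n + C e^{1.9828 m}` (the implied constant may depend on `A`). Not proved here.
[cite: Wright2023PrimeTuplesSiegel, §3 Main Result (first Theorem); Abstract] -/
def wright2023_primeTuples_exp : Prop :=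
  ∀ A : ℝ, 2 < A → StrongSiegelZeros A →
    ∃ C : ℝ, ∀ m : ℕ, 1 ≤ m →
      ∃ᶠ n in atTop, (Nat.nth Nat.Prime (n + m) : ℝ) ≤
        Nat.nth Nat.Prime n + C * Real.exp (1.9828 * m)

/-- **Wright 2024, §3 Main Result, second Theorem (NAMED FACT, as printed; §13 Theorem 13.2, §14).**
"With the same assumptions about Siegel zeroes as given in the previous theorem, we have
`H_2 ≤ 264`, `H_3 ≤ 49,342`, `H_4 ≤ 442,052`, `H_5 ≤ 3,788,384`." (`H_m = liminf (p_{n+m} − p_n)`;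
"all of these are better results than the assumption of Elliott–Halberstam".) Not proved here.
[cite: Wright2023PrimeTuplesSiegel, §3 Main Result (second Theorem), Theorem 13.2 and §14] -/
def wright2023_primeTuples_small : Prop :=
  ∀ A : ℝ, 2 < A → StrongSiegelZeros A →
    (∃ᶠ n in atTop, Nat.nth Nat.Prime (n + 2) ≤ Nat.nth Nat.Prime n + 264) ∧
      (∃ᶠ n in atTop, Nat.nth Nat.Prime (n + 3) ≤ Nat.nth Nat.Prime n + 49342) ∧
      (∃ᶠ n in atTop, Nat.nth Nat.Prime (n + 4) ≤ Nat.nth Nat.Prime n + 442052) ∧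
      (∃ᶠ n in atTop, Nat.nth Nat.Prime (n + 5) ≤ Nat.nth Nat.Prime n + 3788384)

/-! ### PROVED comparisons with the column's family of hypotheses -/

/-- For `q ≥ 3`, `1 < log q`. [folklore] -/
private theorem one_lt_log_of_three_le'' {q : ℕ} (hq : 3 ≤ q) : 1 < Real.log q := by
  have hq3 : (3 : ℝ) ≤ (q : ℝ) := by exact_mod_cast hq
  have hlog3 : 1 < Real.log 3 := by
    have h := Real.exp_one_lt_d9
    rw [Real.lt_log_iff_exp_lt (by norm_num)]
    linarith
  exact lt_of_lt_of_le hlog3 (Real.log_le_log (by norm_num) hq3)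

/-- The exponent `N = r^r + A` is at least `2` once `A ≥ 1` (indeed astronomically large); we only
use `N ≥ 2` and `N − 1 ≥ 1`. [cite: IwaniecConversations2006, §9.1 (9.2)] -/
private theorem two_le_exponent {A : ℝ} (hA : 1 ≤ A) : (2 : ℝ) ≤ (FI2003.r : ℝ) ^ FI2003.r + A := by
  have h1 : (1 : ℝ) ≤ (FI2003.r : ℝ) ^ FI2003.r := by
    have := FI2003.one_le_r_pow_r
    exact_mod_cast this
  linarith

/-- A witness of `StrongSiegelZeros A` (`A ≥ 1`) at a conductor `D ≥ 3` has `0 < 1 − β < (log D)^{−N}`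
with `N = r^r + A`, hence `1 − β < 1/log D` and `β < 1`. [cite: Wright2023PrimeTuplesSiegel, §3 Main Result] -/
private theorem witness_bounds {A : ℝ} (hA : 1 ≤ A) {D : ℕ} [NeZero D] (hD3 : 3 ≤ D)
    {χ : DirichletCharacter ℂ D} (hne : χ ≠ 1) {β : ℝ} (hzero : χ.LFunction β = 0)
    (hβ : 1 - 1 / Real.log D ^ ((FI2003.r : ℝ) ^ FI2003.r + A) < β) :
    β < 1 ∧ 1 - β < 1 / Real.log D ^ ((FI2003.r : ℝ) ^ FI2003.r + A) ∧
      1 / Real.log D ^ ((FI2003.r : ℝ) ^ FI2003.r + A) ≤ 1 / Real.log D ^ (2 : ℝ) := by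
  have hlog1 : 1 < Real.log D := one_lt_log_of_three_le'' hD3
  have hN := two_le_exponent hA
  refine ⟨?_, by linarith, ?_⟩
  · by_contra hge
    rw [not_lt] at hge
    exact DirichletCharacter.LFunction_ne_zero_of_one_le_re χ (Or.inl hne)
      (by rwa [Complex.ofReal_re]) hzero
  · apply one_div_le_one_div_of_le (Real.rpow_pos_of_pos (by linarith) _)
    exact Real.rpow_le_rpow_of_exponent_le hlog1.le hN

/-- **Wright's hypothesis implies Tao–Teräväinen's `UnboundedSiegelZeros`** (`A ≥ 1`): a real zero
`β > 1 − (log D)^{−N}`, `N = r^r + A ≥ 2`, has quality `η = 1/((1−β) log D) > (log D)^{N−1} ≥ log D`,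
unbounded along the witnesses. [cite: Wright2023PrimeTuplesSiegel, §3 Main Result]
[cite: TaoTeravainen2021, Definition 1.4] -/
theorem WrightPrimeTuples.StrongSiegelZeros.unboundedSiegelZeros {A : ℝ} (hA : 1 ≤ A)
    (h : StrongSiegelZeros A) : Summit.Parity.GeneralizedHardyLittlewood.UnboundedSiegelZeros := by
  intro η₀ q₀
  -- witness at a conductor with `log D ≥ max η₀ 10`
  set T : ℝ := max η₀ 10 with hTdef
  obtain ⟨D, hDne, χ, β, hq₀, hprim, hquad, hne, hzero, hβ⟩ := h (max q₀ (⌈Real.exp T⌉₊ + 3))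
  have hD3 : 3 ≤ D := by
    have := le_trans (le_max_right _ _) hq₀; omega
  have hlog1 : 1 < Real.log D := one_lt_log_of_three_le'' hD3
  have hlog0 : 0 < Real.log D := by linarith
  have hlogT : T ≤ Real.log D := by
    have hDexp : Real.exp T ≤ (D : ℝ) := by
      have h1 : Real.exp T ≤ (⌈Real.exp T⌉₊ : ℝ) := Nat.le_ceil _
      have h2 : ((⌈Real.exp T⌉₊ + 3 : ℕ) : ℝ) ≤ (D : ℝ) := by
        exact_mod_cast le_trans (le_max_right _ _) hq₀
      push_cast at h2
      linarith
    rw [Real.le_log_iff_exp_le (by positivity)]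
    exact hDexp
  obtain ⟨hβ1, hgap, hcmp⟩ := witness_bounds hA hD3 hne hzero hβ
  have hδ : 0 < 1 - β := by linarith
  -- the quality
  set η : ℝ := 1 / ((1 - β) * Real.log D) with hηdef
  have hηpos : 0 < η := by positivity
  -- `(1 − β) log D < (log D)^{1−2} · log D = 1/log D`... precisely `(1−β) < 1/(log D)^2`, so
  -- `(1−β) log D < 1/log D ≤ 1/T`, i.e. `η > T`.
  have hprod : (1 - β) * Real.log D < 1 / Real.log D := by
    have h2 : 1 - β < 1 / Real.log D ^ (2 : ℝ) := lt_of_lt_of_le hgap hcmp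
    rw [Real.rpow_two] at h2
    calc (1 - β) * Real.log D < 1 / Real.log D ^ 2 * Real.log D :=
          mul_lt_mul_of_pos_right h2 hlog0
      _ = 1 / Real.log D := by field_simp
  have hηT : T < η := by
    rw [hηdef, lt_one_div (by positivity) (by positivity)]
    calc (1 - β) * Real.log D < 1 / Real.log D := hprod
      _ ≤ 1 / T := one_div_le_one_div_of_le (by positivity) hlogT
  refine ⟨D, hDne, χ, η, le_trans (le_max_left _ _) hq₀, ?_, hprim, hquad, ?_, ?_⟩
  · linarith [le_max_left η₀ 10]
  · linarith [le_max_right η₀ 10]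
  · -- `1 − 1/(η log D) = β`
    have : 1 - 1 / (η * Real.log D) = β := by
      rw [hηdef]
      field_simp
      ring
    rw [this]
    exact hzero

/-- **Under a wide table every witness of Wright's hypothesis lies above the table** (`A ≥ 1`):
`NoRealZeroUpTo Q` and a witness `(D, χ, β)` force `D > Q` (the zero `β ∈ (0, 1)` is forbidden on
the table's range; `β > 1 − 1/log D > 0`). Instance: `Q = 10¹⁰` under the leaf `NoRealZeroUpTo_1e10`.
[cite: Wright2023PrimeTuplesSiegel, §3 Main Result] -/
theorem WrightPrimeTuples.StrongSiegelZeros.witness_above {Q : ℕ} (hW : NoRealZeroUpTo Q) {A : ℝ}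
    (hA : 1 ≤ A) {D : ℕ} [NeZero D] (hD3 : 3 ≤ D) {χ : DirichletCharacter ℂ D}
    (hprim : χ.IsPrimitive) (hquad : χ.IsQuadratic) (hne : χ ≠ 1) {β : ℝ}
    (hzero : χ.LFunction β = 0) (hβ : 1 - 1 / Real.log D ^ ((FI2003.r : ℝ) ^ FI2003.r + A) < β) :
    Q < D := by
  by_contra hle
  rw [not_lt] at hle
  have hlog1 : 1 < Real.log D := one_lt_log_of_three_le'' hD3
  obtain ⟨hβ1, hgap, hcmp⟩ := witness_bounds hA hD3 hne hzero hβ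
  have hβ0 : 0 < β := by
    have h2 : 1 / Real.log D ^ (2 : ℝ) ≤ 1 := by
      rw [div_le_one (Real.rpow_pos_of_pos (by linarith) _), Real.rpow_two]
      nlinarith
    linarith
  exact hW D hD3 hle χ hquad hprim β hβ0 hβ1 hzero

/-- **Exceptional characters of strength `r^r + A + 1` give Wright's hypothesis** (`A ≥ 2`): by the
tree's PROVED Hecke–Landau converse (`exists_exceptionalZero_of_norm_LFunction_one_lt`:
`‖L(1,χ)‖ < A₀/log²(4q)` ⇒ a real zero `β₁` with `1 − β₁ ≤ K‖L(1,χ)‖`), a character with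
`‖L(1,χ)‖ ≤ (log q)^{−(N+1)}` at a large conductor has `1 − β₁ ≤ K (log q)^{−N−1} < (log q)^{−N}`.
[cite: Wright2023PrimeTuplesSiegel, §3 Main Result] [cite: MontgomeryVaughan2007, Theorem 11.4 (11.10)] -/
theorem WrightPrimeTuples.StrongSiegelZeros.of_strength {A : ℝ} (hA : 2 ≤ A)
    (h : ExceptionalCharactersOfStrength ((FI2003.r : ℝ) ^ FI2003.r + A + 1)) :
    StrongSiegelZeros A := by
  intro q₀
  obtain ⟨c, hc, A₀, hA₀, K, hK, hH⟩ := exists_exceptionalZero_of_norm_LFunction_one_lt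
  set N : ℝ := (FI2003.r : ℝ) ^ FI2003.r + A with hNdef
  have hN2 : 2 ≤ N := two_le_exponent (by linarith)
  -- threshold: `log q > max K (4/A₀)` (and `q ≥ 4`)
  set T : ℝ := max K (4 / A₀) + 1 with hTdef
  obtain ⟨q, hqne, χ, hq, hprim, hne, hquad, hL⟩ := h (max q₀ (⌈Real.exp T⌉₊ + 4))
  have hq4 : 4 ≤ q := by have := le_trans (le_max_right _ _) hq; omega
  have hq3 : 3 ≤ q := by omega
  have hlog1 : 1 < Real.log q := one_lt_log_of_three_le'' hq3
  have hlog0 : 0 < Real.log q := by linarith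
  have hlogT : T ≤ Real.log q := by
    have hqexp : Real.exp T ≤ (q : ℝ) := by
      have h1 : Real.exp T ≤ (⌈Real.exp T⌉₊ : ℝ) := Nat.le_ceil _
      have h2 : ((⌈Real.exp T⌉₊ + 4 : ℕ) : ℝ) ≤ (q : ℝ) := by
        exact_mod_cast le_trans (le_max_right _ _) hq
      push_cast at h2
      linarith
    rw [Real.le_log_iff_exp_le (by positivity)]
    exact hqexp
  have hlogK : K < Real.log q := by
    have : K ≤ max K (4 / A₀) := le_max_left _ _
    linarith
  have hlogA : 4 / A₀ < Real.log q := by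
    have : 4 / A₀ ≤ max K (4 / A₀) := le_max_right _ _
    linarith
  -- powers of `log q`
  have hpowN : 0 < Real.log q ^ N := Real.rpow_pos_of_pos hlog0 _
  have hsplit : Real.log q ^ (-(N + 1)) = 1 / (Real.log q ^ N * Real.log q) := by
    rw [show -(N + 1) = -(N + 1) by ring, Real.rpow_neg hlog0.le, Real.rpow_add_one hlog0.ne',
      one_div]
  -- `‖L(1,χ)‖ ≤ (log q)^{-(N+1)} = 1/((log q)^N log q)`
  have hL' : ‖χ.LFunction 1‖ ≤ 1 / (Real.log q ^ N * Real.log q) := by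
    have hL2 : ‖χ.LFunction 1‖ ≤ Real.log q ^ (-(N + 1)) := hL
    rwa [hsplit] at hL2
  -- smallness needed by the converse theorem: `1/((log q)^N log q) < A₀/(log 4q)^2`
  have hlog4q : Real.log (4 * q) ≤ 2 * Real.log q := by
    have hq4r : (4 : ℝ) ≤ q := by exact_mod_cast hq4
    rw [Real.log_mul (by norm_num) (by positivity)]
    have : Real.log 4 ≤ Real.log q := Real.log_le_log (by norm_num) hq4r
    linarith
  have hlog4q0 : 0 < Real.log (4 * q) := by
    have : (1 : ℝ) < 4 * q := by
      have hq4r : (4 : ℝ) ≤ q := by exact_mod_cast hq4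
      linarith
    exact Real.log_pos this
  have hsmall : ‖χ.LFunction 1‖ < A₀ / Real.log (4 * q) ^ 2 := by
    -- `(log q)^N ≥ (log q)^2 = log q · log q`, so `1/((log q)^N log q) ≤ 1/(log q)^2 · (1/log q)`
    have hN' : Real.log q ^ (2 : ℝ) ≤ Real.log q ^ N :=
      Real.rpow_le_rpow_of_exponent_le hlog1.le hN2
    rw [Real.rpow_two] at hN'
    have h1 : 1 / (Real.log q ^ N * Real.log q) ≤ 1 / (Real.log q ^ 2 * Real.log q) :=
      one_div_le_one_div_of_le (by positivity) (mul_le_mul_of_nonneg_right hN' hlog0.le)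
    -- `1/((log q)^2 log q) < A₀/(4 (log q)^2) ≤ A₀/(log 4q)^2`
    have h2 : 1 / (Real.log q ^ 2 * Real.log q) < A₀ / (4 * Real.log q ^ 2) := by
      rw [div_lt_div_iff₀ (by positivity) (by positivity)]
      have : 4 < A₀ * Real.log q := by
        have := (div_lt_iff₀ hA₀).1 hlogA
        linarith [mul_comm A₀ (Real.log q)]
      nlinarith [pow_pos hlog0 2]
    have h3 : A₀ / (4 * Real.log q ^ 2) ≤ A₀ / Real.log (4 * q) ^ 2 := by
      apply div_le_div_of_nonneg_left hA₀.le (by positivity)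
      nlinarith
    linarith
  obtain ⟨β₁, hβlo, hβhi, hβzero, -, -, -, hβK, -⟩ := hH q χ hne hsmall
  refine ⟨q, hqne, χ, β₁, le_trans (le_max_left _ _) hq, hprim, hquad, hne, hβzero, ?_⟩
  -- `1 − β₁ ≤ K‖L(1,χ)‖ ≤ K/((log q)^N log q) < 1/(log q)^N`
  have hfin : 1 - β₁ < 1 / Real.log q ^ N := by
    calc 1 - β₁ ≤ K * ‖χ.LFunction 1‖ := hβK
      _ ≤ K * (1 / (Real.log q ^ N * Real.log q)) := mul_le_mul_of_nonneg_left hL' hK.le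
      _ < 1 / Real.log q ^ N := by
          rw [mul_one_div, div_lt_div_iff₀ (by positivity) hpowN]
          have : K * Real.log q ^ N < Real.log q ^ N * Real.log q := by
            rw [mul_comm]
            exact mul_lt_mul_of_pos_left hlogK hpowN
          nlinarith
  show 1 - 1 / Real.log q ^ N < β₁
  linarith

/-- **Wright's hypothesis implies Friedlander–Iwaniec's `η(D) ≤ ε` at arbitrarily large conductors,
for every `ε > 0`** (`A ≥ 2`), via Benli–Goel–Twiss–Zaman's explicit Lemma 2.9 (named fact `h29`:
`L(1,χ) ≤ 0.18 log²D (1 − β)` for a real zero `β ∈ (1 − 1/(10 log D), 1)`, `D > 4·10⁵`):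
`η(D) = L(1,χ) log D ≤ 0.18 (log D)³ (1 − β) < 0.18 (log D)^{3−N} ≤ 0.18/log D`. So under Wright's
hypothesis the Heath-Brown / Friedlander–Iwaniec twin-prime theorem applies as well (`H_1 = 2`).
[cite: Wright2023PrimeTuplesSiegel, §3 Main Result] [cite: BenliGoelTwissZaman2025, Lemma 2.9] -/
theorem WrightPrimeTuples.StrongSiegelZeros.smallEtaCharacters {A : ℝ} (hA : 2 ≤ A)
    (h : StrongSiegelZeros A) (h29 : BGTZ2025.lemma29) {ε : ℝ} (hε : 0 < ε) :
    SmallEtaCharacters ε := by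
  intro q₀
  set N : ℝ := (FI2003.r : ℝ) ^ FI2003.r + A with hNdef
  have hN4 : 4 ≤ N := by
    have h1 : (1 : ℝ) ≤ (FI2003.r : ℝ) ^ FI2003.r := by exact_mod_cast FI2003.one_le_r_pow_r
    -- `r^r ≥ r ≥ 2`
    have h2 : (2 : ℝ) ≤ (FI2003.r : ℝ) ^ FI2003.r := by
      have hr1 : 1 ≤ FI2003.r := by unfold FI2003.r; norm_num
      have hr2 : 2 ≤ FI2003.r := by unfold FI2003.r; norm_num
      have : FI2003.r ≤ FI2003.r ^ FI2003.r := by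
        calc FI2003.r = FI2003.r ^ 1 := (pow_one _).symm
          _ ≤ FI2003.r ^ FI2003.r := Nat.pow_le_pow_right hr1 hr1
      have h' : (2 : ℝ) ≤ (FI2003.r : ℝ) := by exact_mod_cast hr2
      have h'' : ((FI2003.r : ℕ) : ℝ) ≤ ((FI2003.r ^ FI2003.r : ℕ) : ℝ) := by exact_mod_cast this
      rw [Nat.cast_pow] at h''
      linarith
    rw [hNdef]; linarith
  -- threshold: `log D ≥ max 10 (0.18/ε + 1)`
  set T : ℝ := max 10 (0.18 / ε + 1) with hTdef
  obtain ⟨D, hDne, χ, β, hq₀, hprim, hquad, hne, hzero, hβ⟩ :=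
    h (max (max q₀ 400001) (⌈Real.exp T⌉₊ + 3))
  have hD4e5 : 400000 < D := by
    have := le_trans (le_max_right _ _) (le_trans (le_max_left _ _) hq₀); omega
  have hD3 : 3 ≤ D := by omega
  have hlog1 : 1 < Real.log D := one_lt_log_of_three_le'' hD3
  have hlog0 : 0 < Real.log D := by linarith
  have hlogT : T ≤ Real.log D := by
    have hDexp : Real.exp T ≤ (D : ℝ) := by
      have h1 : Real.exp T ≤ (⌈Real.exp T⌉₊ : ℝ) := Nat.le_ceil _
      have h2 : ((⌈Real.exp T⌉₊ + 3 : ℕ) : ℝ) ≤ (D : ℝ) := by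
        exact_mod_cast le_trans (le_max_right _ _) hq₀
      push_cast at h2
      linarith
    rw [Real.le_log_iff_exp_le (by positivity)]
    exact hDexp
  have hlog10 : 10 ≤ Real.log D := le_trans (le_max_left _ _) hlogT
  have hlogε : 0.18 / ε + 1 ≤ Real.log D := le_trans (le_max_right _ _) hlogT
  obtain ⟨hβ1, hgap, -⟩ := witness_bounds (by linarith : (1 : ℝ) ≤ A) hD3 hne hzero hβ
  -- `(log D)^N ≥ (log D)^4`, so `1 − β < (log D)^{-4}`
  have hpow4 : Real.log D ^ (4 : ℝ) ≤ Real.log D ^ N :=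
    Real.rpow_le_rpow_of_exponent_le hlog1.le hN4
  have hL4 : Real.log D ^ (4 : ℝ) = Real.log D ^ (4 : ℕ) := by exact_mod_cast Real.rpow_natCast _ 4
  have hgap4 : 1 - β < 1 / Real.log D ^ (4 : ℕ) := by
    rw [← hNdef] at hgap
    rw [← hL4]
    exact lt_of_lt_of_le hgap (one_div_le_one_div_of_le (by positivity) hpow4)
  -- the Landau–Siegel window of Lemma 2.9: `1 − 1/(10 log D) < β`
  have hwin : 1 - 1 / (10 * Real.log D) < β := by
    have h1 : 1 / Real.log D ^ (4 : ℕ) ≤ 1 / (10 * Real.log D) := by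
      apply one_div_le_one_div_of_le (by positivity)
      have : 10 * Real.log D ≤ Real.log D * Real.log D := by nlinarith
      calc 10 * Real.log D ≤ Real.log D ^ 2 := by nlinarith
        _ ≤ Real.log D ^ 4 := by
            have := pow_le_pow_right₀ hlog1.le (by norm_num : 2 ≤ 4); exact this
    linarith
  obtain ⟨hlow, hup⟩ := h29 D hD4e5 χ hquad hne β hwin hβ1 hzero
  -- `L(1,χ)` is real and positive, so `‖L(1,χ)‖ = Re L(1,χ)`
  have hsq : χ ^ 2 = 1 := MulChar.isQuadratic_iff_sq_eq_one.mp hquad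
  have him : (χ.LFunction 1).im = 0 := Siegel.LFunction_one_im_eq_zero χ hne hsq
  have hre0 : 0 ≤ (χ.LFunction 1).re := by
    have : 0 ≤ 0.72 * (1 - β) := by nlinarith
    linarith
  have hnorm : ‖χ.LFunction 1‖ = (χ.LFunction 1).re := by
    rw [← Complex.re_add_im (χ.LFunction 1), him]
    simp [abs_of_nonneg hre0]
  refine ⟨D, hDne, χ, le_trans (le_max_left _ _) (le_trans (le_max_left _ _) hq₀), hD3, hprim,
    hquad, ?_⟩
  rw [hnorm]
  -- `Re L(1,χ) · log D ≤ 0.18 (log D)^3 (1 − β) < 0.18 (log D)^3/(log D)^4 = 0.18/log D ≤ ε`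
  have hlog3 : 0 < Real.log D ^ 3 := pow_pos hlog0 3
  calc (χ.LFunction 1).re * Real.log D
      ≤ 0.18 * Real.log D ^ 2 * (1 - β) * Real.log D :=
        mul_le_mul_of_nonneg_right hup hlog0.le
    _ = 0.18 * Real.log D ^ 3 * (1 - β) := by ring
    _ ≤ 0.18 * Real.log D ^ 3 * (1 / Real.log D ^ 4) :=
        mul_le_mul_of_nonneg_left hgap4.le (by positivity)
    _ = 0.18 / Real.log D := by field_simp
    _ ≤ ε := by
        rw [div_le_iff₀ hlog0]
        have : 0.18 / ε ≤ Real.log D - 1 := by linarith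
        have h' := (div_le_iff₀ hε).1 this
        nlinarith

/-- **Wright's hypothesis implies Friedlander–Iwaniec's `η(D) ≤ ε` at arbitrarily large conductors, for
every `ε > 0` (`A ≥ 2`) — the same conclusion as `StrongSiegelZeros.smallEtaCharacters` WITHOUT the named
fact `BGTZ2025.lemma29`:** at a real zero `β ≥ 1 − 1/(40 log D)` of a PRIMITIVE `χ` mod `D ≥ 232` the tree
proves `‖L(1,χ)‖ ≤ (1 − β) log² D` (`DirichletAbel.norm_LFunction_one_le_log_sq_of_realZero`, the explicit
upper half of Montgomery–Vaughan's (11.10)); a witness of Wright's hypothesis has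
`1 − β < (log D)^{−N} ≤ (log D)^{−4} ≤ 1/(40 log D)` once `log D ≥ 10`, so
`η(D) = ‖L(1,χ)‖ log D ≤ (log D)³ (1 − β) < 1/log D ≤ ε`. (Theory ruling E-lemma29-upper, CONDITIONALS
v1.3r: Benli–Goel–Twiss–Zaman's Lemma 2.9 is printed for every real `χ₁` but its source, Bordignon 2019,
covers primitive `χ₁` only; this consumer is primitive and constant-insensitive, hence re-pointed to the
kernel bound.) [cite: Wright2023PrimeTuplesSiegel, §3 Main Result]
[cite: MontgomeryVaughan2007, Theorem 11.4 (11.10)] -/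
theorem WrightPrimeTuples.StrongSiegelZeros.smallEtaCharacters_of_logSq {A : ℝ} (hA : 2 ≤ A)
    (h : StrongSiegelZeros A) {ε : ℝ} (hε : 0 < ε) :
    SmallEtaCharacters ε := by
  intro q₀
  set N : ℝ := (FI2003.r : ℝ) ^ FI2003.r + A with hNdef
  have hN4 : 4 ≤ N := by
    have h2 : (2 : ℝ) ≤ (FI2003.r : ℝ) ^ FI2003.r := by
      have hr1 : 1 ≤ FI2003.r := by unfold FI2003.r; norm_num
      have hr2 : 2 ≤ FI2003.r := by unfold FI2003.r; norm_num
      have : FI2003.r ≤ FI2003.r ^ FI2003.r := by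
        calc FI2003.r = FI2003.r ^ 1 := (pow_one _).symm
          _ ≤ FI2003.r ^ FI2003.r := Nat.pow_le_pow_right hr1 hr1
      have h' : (2 : ℝ) ≤ (FI2003.r : ℝ) := by exact_mod_cast hr2
      have h'' : ((FI2003.r : ℕ) : ℝ) ≤ ((FI2003.r ^ FI2003.r : ℕ) : ℝ) := by exact_mod_cast this
      rw [Nat.cast_pow] at h''
      linarith
    rw [hNdef]; linarith
  -- threshold: `log D ≥ max 10 (1/ε + 1)` and `D ≥ 232`
  set T : ℝ := max 10 (1 / ε + 1) with hTdef
  obtain ⟨D, hDne, χ, β, hq₀, hprim, hquad, hne, hzero, hβ⟩ :=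
    h (max (max q₀ 232) (⌈Real.exp T⌉₊ + 3))
  have hD232 : 232 ≤ D := by
    have := le_trans (le_max_right _ _) (le_trans (le_max_left _ _) hq₀); omega
  have hD3 : 3 ≤ D := by omega
  have hlog1 : 1 < Real.log D := one_lt_log_of_three_le'' hD3
  have hlog0 : 0 < Real.log D := by linarith
  have hlogT : T ≤ Real.log D := by
    have hDexp : Real.exp T ≤ (D : ℝ) := by
      have h1 : Real.exp T ≤ (⌈Real.exp T⌉₊ : ℝ) := Nat.le_ceil _
      have h2 : ((⌈Real.exp T⌉₊ + 3 : ℕ) : ℝ) ≤ (D : ℝ) := by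
        exact_mod_cast le_trans (le_max_right _ _) hq₀
      push_cast at h2
      linarith
    rw [Real.le_log_iff_exp_le (by positivity)]
    exact hDexp
  have hlog10 : 10 ≤ Real.log D := le_trans (le_max_left _ _) hlogT
  have hlogε : 1 / ε + 1 ≤ Real.log D := le_trans (le_max_right _ _) hlogT
  obtain ⟨hβ1, hgap, -⟩ := witness_bounds (by linarith : (1 : ℝ) ≤ A) hD3 hne hzero hβ
  -- `(log D)^N ≥ (log D)^4`, so `1 − β < (log D)^{-4}`
  have hpow4 : Real.log D ^ (4 : ℝ) ≤ Real.log D ^ N :=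
    Real.rpow_le_rpow_of_exponent_le hlog1.le hN4
  have hL4 : Real.log D ^ (4 : ℝ) = Real.log D ^ (4 : ℕ) := by exact_mod_cast Real.rpow_natCast _ 4
  have hgap4 : 1 - β < 1 / Real.log D ^ (4 : ℕ) := by
    rw [← hNdef] at hgap
    rw [← hL4]
    exact lt_of_lt_of_le hgap (one_div_le_one_div_of_le (by positivity) hpow4)
  -- the window of the kernel bound: `1 − 1/(40 log D) ≤ β` (`40 log D ≤ log⁴ D` as `log D ≥ 10`)
  have hwin : 1 - 1 / (40 * Real.log D) ≤ β := by
    have h1 : 1 / Real.log D ^ (4 : ℕ) ≤ 1 / (40 * Real.log D) := by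
      apply one_div_le_one_div_of_le (by positivity)
      have h3 : (40 : ℝ) ≤ Real.log D ^ 3 := by
        have h10 : (10 : ℝ) ^ 3 ≤ Real.log D ^ 3 := pow_le_pow_left₀ (by norm_num) hlog10 3
        linarith
      calc 40 * Real.log D ≤ Real.log D ^ 3 * Real.log D := mul_le_mul_of_nonneg_right h3 hlog0.le
        _ = Real.log D ^ 4 := by ring
    linarith
  have hup := DirichletAbel.norm_LFunction_one_le_log_sq_of_realZero hD232 hprim hwin hzero
  refine ⟨D, hDne, χ, le_trans (le_max_left _ _) (le_trans (le_max_left _ _) hq₀), hD3, hprim,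
    hquad, ?_⟩
  -- `‖L(1,χ)‖ · log D ≤ (log D)^3 (1 − β) ≤ (log D)^3/(log D)^4 = 1/log D ≤ ε`
  calc ‖χ.LFunction 1‖ * Real.log D
      ≤ (1 - β) * Real.log D ^ 2 * Real.log D := mul_le_mul_of_nonneg_right hup hlog0.le
    _ = Real.log D ^ 3 * (1 - β) := by ring
    _ ≤ Real.log D ^ 3 * (1 / Real.log D ^ 4) :=
        mul_le_mul_of_nonneg_left hgap4.le (by positivity)
    _ = 1 / Real.log D := by field_simp
    _ ≤ ε := by
        rw [div_le_iff₀ hlog0]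
        have : 1 / ε ≤ Real.log D - 1 := by linarith
        have h' := (div_le_iff₀ hε).1 this
        nlinarith

end Literature.NumberTheory.LFunctions

end
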